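import Literature.MathematicalPhysics.QuantumFieldTheory.Balaban1983to89.T4EtaRateSiteTorus
import Literature.MathematicalPhysics.QuantumFieldTheory.Balaban1983to89.B5Hk163Decay

/-!
# `Balaban1983to89.T4EtaRateSiteTorus163` — FROM THE STRIP TO THE SITE LAYER: generic producers reading b04's momentum-space
currency `StripRegular (G₂ − G₁) κ A` into the typed NE2 site layer on the unit torus, and the second inhabitant BY NAME — the
(1.63) `H_k`-multiplier torus kernels of `B5Hk163Decay` — at order zero UNCONDITIONALLY and at first order in `η` CONDITIONALLY on
the strip rate of the level difference, UNIFORMLY IN THE VOLUME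

Cell `pub-balaban`, unit `b2b-balaban-pv25-g18` (the η-rate lineage: `T4EtaRate` p178744, `T4RateAlgebra` p178920,
`T4EtaRateUnitWitness` p185409, `T4EtaRateDefect` p187761, `T4EtaRateDefectSite` p187690, `T4EtaRateSiteOfRatePair` p190922,
`T4EtaRateSiteTorus` p190929; T4-DAG node U1a = the NE2 background layer, record `t4/T4-EST-U1a.md`).  Self-row
T4-U1a.S-NE2-SITE-TORUS163-STRIP° = part (b) of row T4-U1a.S-NE2-SITE-TORUS°: the companion leaf announced in the header of
`T4EtaRateSiteTorus` ("the (1.63) `H_k`-multiplier torus kernels … are read in by the companion leaf `T4EtaRateSiteTorus163`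
through §3's producer").

## The point (§1): the producers one level up

`T4EtaRateSiteTorus` §3/§4 produce the typed shapes `T4EtaRate.EtaRateIneqSite` / `NE2PlusSite` / `T4EtaRateSiteOfRatePair.NE2ZeroSite`
on the torus carrier from a POSITION-SPACE torus step bound `|Xf(x̄) − Xc(x̄)| ≤ A·(L^k)^{−γ}·e^{−δ|x|_{T,∞}}`.  Every torus rate
theorem of the tree obtains that bound the same way: the two kernels are `MultiPeriod.torusKernel`s of `B4TorusKernel.descendC`
of two STRIP-REGULAR multipliers `G₁` (coarse), `G₂` (fine) on `Strip (d+1) κ` (`B4ContourShift.StripRegular`, seat b04's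
engine), the DIFFERENCE `G₂ − G₁` is strip-regular with bound = THE RATE, and `torusKernel_descend_decay_torusMetric` turns a
strip bound into amplitude × `periodConst(κ, d)` × `e^{−(κ/(d+1))|x|_{T,∞}}`, uniformly in the period vector.  §1 packages
this once and for all: from `StripRegular (G₂ − G₁) κ (A·(L^k)^{−γ})` (resp. `A/L^k`) straight to `EtaRateIneqSite` with
constants `(A·periodConst(κ,d), κ/(d+1), γ)`, and, for a scale-indexed multiplier family `G k` with
`StripRegular (G (k+1) − G k) κ (A·(L^k)^{−γ})` for all `k`, to `NE2PlusSite` / `NE2ZeroSite` on the `(k, N, M)`-family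
(`stripTorusFamily`) — the momentum-space interface of the site layer.

## The (1.63) inhabitant (§2–§4)

§2 names the objects: `hk163TorusKernel n μ λ a N x := torusKernel (descendC (B5Hk163Decay.G163 n μ λ a) (stripRegular_G163 …)) N x`
— literally the kernel of `B5Hk163Decay.torusKernel_G163_decay` — its real part at the box representative `hk163Re`, the
zero fine offset `zeroOffset` and the zero-offset scale family `hk163ZeroFamily L μ λ : N ↦ k ↦ Re K^{(L^k)}_{0,N}`.
§3 (UNCONDITIONAL, order zero): from b05's decay theorem alone the two-level difference obeys
`|X_N(k+1)(x̄) − X_N k(x̄)| ≤ 2·MG163(d+1)·periodConst·e^{−delta163T d·|x|_{T,∞}}` for every pair of offsets, hence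
`EtaRateIneqSite … (C163T0 d) (delta163T d) 0 U` — decay and volume-uniformity BY NAME, NO η-rate (`γ = 0`; the packaged
`NE2PlusSite` / `NE2ZeroSite` demand `γ > 0` and are NOT reached at this order — stated to isolate exactly what the strip rate adds).
§4 (CONDITIONAL, first order): under the hypothesis — inline, in b04's existing currency, no statement of ours minted as a fact —
`StripRegular (fun p => G163 (L^(k+1)) μ λ a′ p − G163 (L^k) μ λ a p) (kappa163 (d+1)) (A / L^k)`, the (1.63) kernels inhabit
`EtaRateIneqSite … (A·periodConst(κ₁₆₃(d+1),d)) (delta163T d) 1 U`, and under the family form of the hypothesis at the zero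
offset the zero-offset family inhabits `NE2PlusSite` and `NE2ZeroSite`, uniformly in the volume.  STATUS OF THE HYPOTHESIS: it is a
THEOREM OF THE TREE — `T4Hk163StripRate.stripRegular_G163_sub` (seat t4-ne2-p2, §5 there), with `A = CGe (d+1)`, for
`1 ≤ n ≤ m` and physically paired offsets `a′·n = a·m`; the hypothesis-free corollaries (the by-name discharge) are the
companion leaf `T4EtaRateSiteTorus163King`, which adds the import `T4Hk163StripRate`; this file deliberately stops at the import
cone `T4EtaRateSiteTorus` + `B5Hk163Decay`.

## What is here (0 sorry; every declaration [folklore] = elementary bookkeeping, or a shape-location [cite])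

* §1 `norm_torusKernel_sub_le_of_stripRegular`, `stripTorusRe`, `stripTorusRe_toT`, `abs_stripTorusRe_sub_le`,
  `etaRateIneqSite_torus_of_stripRegular_rpow`, `etaRateIneqSite_torus_of_stripRegular`, `stripTorusFamily`,
  `ne2PlusSite_torus_of_stripRegular_rpow`, `ne2PlusSite_torus_of_stripRegular`, `ne2ZeroSite_torus_of_stripRegular_rpow`,
  `ne2ZeroSite_torus_of_stripRegular`.
* §2 `hk163TorusKernel`, `hk163TorusKernel_rep_toT`, `hk163Re`, `hk163Re_eq_stripTorusRe`, `delta163T`, `delta163T_pos`,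
  `zeroOffset`, `zeroOffset_phys`, `hk163ZeroFamily`, `hk163ZeroFamily_eq_stripTorusFamily`.
* §3 `C163T0`, `abs_hk163Re_le`, `hk163_step_bound_zero`, `etaRateIneqSite_hk163_zero`.
* §4 `hk163_step_bound_of_stripRate`, `etaRateIneqSite_hk163_of_stripRate`, `ne2PlusSite_hk163Zero_of_stripRate`,
  `ne2ZeroSite_hk163Zero_of_stripRate`.

## HONEST SCOPE / what is NOT claimed

(i) As `T4EtaRateSiteTorus` (i)/(ii)/(iv): `U ≡ 1`, single scale, linear layer, arbitrary period vector; in the family theorems the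
background quantifier of `NE2PlusSite` ranges over `{U ≡ 1}` — NE2⁰ CONTENT inside NE2⁺'s TYPE; NE2⁺ (NOT PRINTED) is neither
printed nor claimed; the cube-size index `M` is inert.  (ii) The identification of the (1.63) torus kernels with matrix elements of
Bałaban's `H_k` between a fine point `y′ + a/n` and a coarse point `y` is the one stated in `B5Hk163Decay` §4 and is not
re-derived; the multipliers are b05's AUDIT CONSTRUCTION (B5 prints no decay or rate display for (1.63) on pp. 28–29).  (iii) §4 is
CONDITIONAL as typed; this file does not prove the strip rate and does not import the module that does.  (iv) Nothing printed is
used as a hypothesis; the [cite] tags locate SHAPES/OBJECTS only: [Balaban1984PropagatorsI] (1.63) p. 28 (the object, through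
`B5Hk163Decay.G163`); [B9] = [Balaban1985BackgroundPropagators] Thm 3.2 (3.48) p. 398 and Thm 3.14 pp. 426–427 (normalisation /
quantifier template, as typed by `T4EtaRate`); [King1986] Lemma 4.5 (4.38) p. 674 (the printed `A = 0` sibling of the shape).
NOT NE2⁺, NOT NE1′, NOT continuum, NOT infinite-volume Yang–Mills, NOT a mass gap, NOT Clay; rung (B)+1 finite-`T⁴` scoping;
NOT summit progress.

HONEST FRAMING (cell framing — a paraphrase of `HOME/t4/T4-DAG.md` PAGE 1, wording inherited from the headers of this lineage's
earlier leaves): T4 is OPEN. The deliverables are: located quotations, a uniformity census, typed hypothesis shapes, estimate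
sketches with every non-printed step flagged, and kernel-checked bookkeeping lemmas. None of this is summit progress.

ABSOLUTE RULE (cell, verbatim): No internally-minted statement may enter as a cited fact. Every hypothesis is either
kernel-proved in this package or a verbatim quotation of a PUBLISHED theorem with page reference. The manuscript(s) under
audit are NOT citable for their own disputed steps — they are the thing under adjudication; programme-internal
(2001/route/tribunal) claims are never citable.

Imports BY NAME, nothing modified: `T4EtaRateSiteTorus` (own lineage: the carrier `torusSiteGeo` / `torusStepKernel` /
`TorusIndex` / `torusInstance` / `TorusFamily` / `torusStepKernels`, `torusKernel_rep_toT`, the producers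
`etaRateIneqSite_torus_of_bound(_rpow)`, `ne2PlusSite_torus_of_bound(_rpow)`, `ne2ZeroSite_torus_of_bound(_rpow)`; through it
`T4EtaRate`, `T4EtaRateSiteOfRatePair.NE2ZeroSite`, `T4EtaRateDefectSite.pt9Bg`, seat t4-ne2-p2's
`T4GaugeActionRateStrip.torusKernel_descendC_sub`, and the torus infrastructure of seats b04 / b06: `B4ContourShift.StripRegular`,
`B4TorusKernel.descendC` / `periodConst`, `B4TorusKernel.MultiPeriod` (`torusKernel`, `torusSupNorm`,
`torusKernel_descend_decay_torusMetric`), `B5Prop11Plancherel.Tor`, `B6LowerBound2153Torus` (`toT`, `rep`), `B6Cov2156Torus.one_le_M`);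
`B5Hk163Decay` (seat b05: `G163`, `stripRegular_G163`, `MG163`, `MG163_nonneg`, `torusKernel_G163_decay`; through it
`B5Hk163Strip.kappa163(_pos)`).
-/

namespace Literature.MathematicalPhysics.QuantumFieldTheory.Balaban1983to89.T4EtaRateSiteTorus163

open Complex
open T4EtaRate (EtaRateIneqSite NE2PlusSite PairedInstance)
open T4EtaRateDefectSite (pt9Bg)
open T4EtaRateSiteOfRatePair (NE2ZeroSite)
open T4EtaRateSiteTorus (torusSiteGeo torusStepKernel TorusIndex torusInstance TorusFamily torusStepKernels torusKernel_rep_toT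
  etaRateIneqSite_torus_of_bound_rpow etaRateIneqSite_torus_of_bound ne2PlusSite_torus_of_bound_rpow ne2PlusSite_torus_of_bound
  ne2ZeroSite_torus_of_bound_rpow ne2ZeroSite_torus_of_bound)
open B5Prop11Plancherel (Tor)
open B6LowerBound2153Torus (toT rep)
open B6Cov2156Torus (one_le_M)
open B4ContourShift (StripRegular)
open B4TorusKernel (descendC periodConst)
open B4TorusKernel.MultiPeriod (torusKernel torusSupNorm torusSupNorm_nonneg torusKernel_descend_decay_torusMetric)
open T4GaugeActionRateStrip (torusKernel_descendC_sub)
open B5Hk163Strip (kappa163 kappa163_pos)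
open B5Hk163Decay (G163 stripRegular_G163 MG163 MG163_nonneg torusKernel_G163_decay)

noncomputable section

variable {d : ℕ}

/-! ## §1 From the strip to the site layer: generic producers -/

section StripToSite

/-- **STRIP RATE ⇒ TORUS KERNEL RATE, UNIFORMLY IN THE VOLUME.**  For two strip-regular multipliers `G₁`, `G₂` on `Strip (d+1) κ`
(`κ > 0`) whose DIFFERENCE is strip-regular with bound `A`, on every unit torus (period vector `N`, all `N_μ ≥ 1`) and at every
lattice point `x`: `‖K₂,N(x) − K₁,N(x)‖ ≤ A·periodConst(κ,d)·e^{−(κ/(d+1))|x|_{T,∞}}` — `T4GaugeActionRateStrip.torusKernel_descendC_sub`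
and `B4TorusKernel.MultiPeriod.torusKernel_descend_decay_torusMetric` BY NAME. [folklore] -/
theorem norm_torusKernel_sub_le_of_stripRegular {G₁ G₂ : (Fin (d + 1) → ℂ) → ℂ} {κ M₁ M₂ A : ℝ}
    (h₁ : StripRegular G₁ κ M₁) (h₂ : StripRegular G₂ κ M₂) (h₁₂ : StripRegular (fun p => G₂ p - G₁ p) κ A)
    (hκ : 0 < κ) (N : Fin (d + 1) → ℕ) [∀ μ, NeZero (N μ)] (x : Fin (d + 1) → ℤ) :
    ‖torusKernel (descendC G₂ h₂ hκ.le) N x - torusKernel (descendC G₁ h₁ hκ.le) N x‖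
      ≤ A * periodConst κ d * Real.exp (-(κ / (d + 1) * torusSupNorm N x)) := by
  rw [torusKernel_descendC_sub h₁ h₂ h₁₂ hκ.le N x]
  exact torusKernel_descend_decay_torusMetric _ hκ (one_le_M N) x

/-- THE TORUS KERNEL OF A STRIP-REGULAR MULTIPLIER AS A REAL TORUS FUNCTION (real part, read at the box representative).
[folklore] -/
def stripTorusRe {G : (Fin (d + 1) → ℂ) → ℂ} {κ M : ℝ} (h : StripRegular G κ M) (hκ : 0 < κ)
    (N : Fin (d + 1) → ℕ) [∀ μ, NeZero (N μ)] (t : Tor N) : ℝ :=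
  (torusKernel (descendC G h hκ.le) N (rep N t)).re

/-- At the class of a lattice point the representative may be dropped: `X(x̄) = Re K_N(x)`. [folklore] -/
theorem stripTorusRe_toT {G : (Fin (d + 1) → ℂ) → ℂ} {κ M : ℝ} (h : StripRegular G κ M) (hκ : 0 < κ)
    (N : Fin (d + 1) → ℕ) [∀ μ, NeZero (N μ)] (x : Fin (d + 1) → ℤ) :
    stripTorusRe h hκ N (toT N x) = (torusKernel (descendC G h hκ.le) N x).re := by
  simp only [stripTorusRe, torusKernel_rep_toT]

/-- **STRIP RATE ⇒ TORUS STEP BOUND AT LATTICE REPRESENTATIVES** (real parts): the format consumed by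
`T4EtaRateSiteTorus.etaRateIneqSite_torus_iff_lattice`. [folklore] -/
theorem abs_stripTorusRe_sub_le {G₁ G₂ : (Fin (d + 1) → ℂ) → ℂ} {κ M₁ M₂ A : ℝ}
    (h₁ : StripRegular G₁ κ M₁) (h₂ : StripRegular G₂ κ M₂) (h₁₂ : StripRegular (fun p => G₂ p - G₁ p) κ A)
    (hκ : 0 < κ) (N : Fin (d + 1) → ℕ) [∀ μ, NeZero (N μ)] (x : Fin (d + 1) → ℤ) :
    |stripTorusRe h₂ hκ N (toT N x) - stripTorusRe h₁ hκ N (toT N x)|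
      ≤ A * periodConst κ d * Real.exp (-(κ / (d + 1) * torusSupNorm N x)) := by
  rw [stripTorusRe_toT, stripTorusRe_toT, ← Complex.sub_re]
  exact (abs_re_le_norm _).trans (norm_torusKernel_sub_le_of_stripRegular h₁ h₂ h₁₂ hκ N x)

/-- **STRIP RATE ⇒ THE SITE LAYER** (general rate exponent): if the difference of the fine and the coarse multiplier is
strip-regular with bound `A·(L^k)^{−γ}`, their torus kernels inhabit
`EtaRateIneqSite d′ p (torusStepKernel Xf Xc L M k) (A·periodConst(κ,d)) (κ/(d+1)) γ U` on every unit torus, for every exponent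
pair `(d′, p)`, every (inert) cube size `M`, at `U ≡ 1`.
[cite: Balaban1985BackgroundPropagators, Thm 3.2 (3.48) p.398 (normalisation, shape)] [folklore] -/
theorem etaRateIneqSite_torus_of_stripRegular_rpow {L : ℝ} (hL : 0 < L) (M : ℝ) (k : ℕ)
    {G₁ G₂ : (Fin (d + 1) → ℂ) → ℂ} {κ M₁ M₂ A γ : ℝ}
    (h₁ : StripRegular G₁ κ M₁) (h₂ : StripRegular G₂ κ M₂)
    (h₁₂ : StripRegular (fun p => G₂ p - G₁ p) κ (A * (L ^ k) ^ (-γ))) (hκ : 0 < κ)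
    (N : Fin (d + 1) → ℕ) [∀ μ, NeZero (N μ)] (d' : ℕ) (p : ℝ) (U : pt9Bg.Cfg) :
    EtaRateIneqSite d' p (torusStepKernel (stripTorusRe h₂ hκ N) (stripTorusRe h₁ hκ N) L M k)
      (A * periodConst κ d) (κ / ((d : ℝ) + 1)) γ U := by
  refine etaRateIneqSite_torus_of_bound_rpow hL (fun x => ?_) d' p U
  calc |stripTorusRe h₂ hκ N (toT N x) - stripTorusRe h₁ hκ N (toT N x)|
      ≤ A * (L ^ k) ^ (-γ) * periodConst κ d * Real.exp (-(κ / (d + 1) * torusSupNorm N x)) :=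
        abs_stripTorusRe_sub_le h₁ h₂ h₁₂ hκ N x
    _ = A * periodConst κ d * (L ^ k) ^ (-γ) * Real.exp (-(κ / ((d : ℝ) + 1) * torusSupNorm N x)) := by ring

/-- **STRIP RATE ⇒ THE SITE LAYER**, first order in `η` (`γ = 1`): difference bound `A/L^k`. [folklore] -/
theorem etaRateIneqSite_torus_of_stripRegular {L : ℝ} (hL : 0 < L) (M : ℝ) (k : ℕ)
    {G₁ G₂ : (Fin (d + 1) → ℂ) → ℂ} {κ M₁ M₂ A : ℝ}
    (h₁ : StripRegular G₁ κ M₁) (h₂ : StripRegular G₂ κ M₂)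
    (h₁₂ : StripRegular (fun p => G₂ p - G₁ p) κ (A / L ^ k)) (hκ : 0 < κ)
    (N : Fin (d + 1) → ℕ) [∀ μ, NeZero (N μ)] (d' : ℕ) (p : ℝ) (U : pt9Bg.Cfg) :
    EtaRateIneqSite d' p (torusStepKernel (stripTorusRe h₂ hκ N) (stripTorusRe h₁ hκ N) L M k)
      (A * periodConst κ d) (κ / ((d : ℝ) + 1)) 1 U := by
  refine etaRateIneqSite_torus_of_bound hL (fun x => ?_) d' p U
  calc |stripTorusRe h₂ hκ N (toT N x) - stripTorusRe h₁ hκ N (toT N x)|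
      ≤ A / L ^ k * periodConst κ d * Real.exp (-(κ / (d + 1) * torusSupNorm N x)) :=
        abs_stripTorusRe_sub_le h₁ h₂ h₁₂ hκ N x
    _ = A * periodConst κ d * (L ^ k)⁻¹ * Real.exp (-(κ / ((d : ℝ) + 1) * torusSupNorm N x)) := by
        rw [div_eq_mul_inv]; ring

/-- THE TORUS FAMILY OF A SCALE-INDEXED FAMILY OF STRIP-REGULAR MULTIPLIERS `G k` (`k` = number of scales):
`X_N k = Re K^{(k)}_N` read at the box representative, one for every unit torus. [folklore] -/
def stripTorusFamily (G : ℕ → (Fin (d + 1) → ℂ) → ℂ) {κ : ℝ} {B : ℕ → ℝ} (hG : ∀ k, StripRegular (G k) κ (B k))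
    (hκ : 0 < κ) : TorusFamily d :=
  fun N _ k t => stripTorusRe (hG k) hκ N t

/-- **STRIP RATES, UNIFORM IN THE SCALE, INHABIT `NE2PlusSite` ON THE `(k, N, M)`-FAMILY** (general exponent `γ > 0`): if
`StripRegular (G (k+1) − G k) κ (A·(L^k)^{−γ})` for every `k`, the torus family of `G` has constants
`(M₅, δ, a₀, C, γ) = (1, κ/(d+1), 1, max (A·periodConst(κ,d)) 1, γ)`.  HONEST SCOPE (i): NE2⁰ content inside NE2⁺'s type
(`U ≡ 1`); NOT NE2⁺. [cite: Balaban1985BackgroundPropagators, Thm 3.2 (3.48) p.398 + Thm 3.14 pp.426–427 (quantifier template, as typed by `T4EtaRate.NE2PlusSite`)] [folklore] -/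
theorem ne2PlusSite_torus_of_stripRegular_rpow {L : ℝ} (hL : 0 < L) {G : ℕ → (Fin (d + 1) → ℂ) → ℂ} {κ : ℝ}
    {B : ℕ → ℝ} (hG : ∀ k, StripRegular (G k) κ (B k)) (hκ : 0 < κ) {A γ : ℝ} (hγ : 0 < γ)
    (hsub : ∀ k, StripRegular (fun p => G (k + 1) p - G k p) κ (A * (L ^ k) ^ (-γ))) (d' : ℕ) (p c35 : ℝ) :
    NE2PlusSite d' p c35 (torusInstance d hL.ne') (torusStepKernels (stripTorusFamily G hG hκ) hL.ne') := by
  refine ne2PlusSite_torus_of_bound_rpow hL (A := A * periodConst κ d) (δ := κ / ((d : ℝ) + 1)) (by positivity) hγ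
    (fun N _ k x => ?_) d' p c35
  calc |stripTorusFamily G hG hκ N (k + 1) (toT N x) - stripTorusFamily G hG hκ N k (toT N x)|
      ≤ A * (L ^ k) ^ (-γ) * periodConst κ d * Real.exp (-(κ / (d + 1) * torusSupNorm N x)) :=
        abs_stripTorusRe_sub_le (hG k) (hG (k + 1)) (hsub k) hκ N x
    _ = A * periodConst κ d * (L ^ k) ^ (-γ) * Real.exp (-(κ / ((d : ℝ) + 1) * torusSupNorm N x)) := by ring

/-- The same, first order in `η` (`γ = 1`, difference bounds `A/L^k`). [folklore] -/
theorem ne2PlusSite_torus_of_stripRegular {L : ℝ} (hL : 0 < L) {G : ℕ → (Fin (d + 1) → ℂ) → ℂ} {κ : ℝ}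
    {B : ℕ → ℝ} (hG : ∀ k, StripRegular (G k) κ (B k)) (hκ : 0 < κ) {A : ℝ}
    (hsub : ∀ k, StripRegular (fun p => G (k + 1) p - G k p) κ (A / L ^ k)) (d' : ℕ) (p c35 : ℝ) :
    NE2PlusSite d' p c35 (torusInstance d hL.ne') (torusStepKernels (stripTorusFamily G hG hκ) hL.ne') := by
  refine ne2PlusSite_torus_of_bound hL (A := A * periodConst κ d) (δ := κ / ((d : ℝ) + 1)) (by positivity)
    (fun N _ k x => ?_) d' p c35
  calc |stripTorusFamily G hG hκ N (k + 1) (toT N x) - stripTorusFamily G hG hκ N k (toT N x)|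
      ≤ A / L ^ k * periodConst κ d * Real.exp (-(κ / (d + 1) * torusSupNorm N x)) :=
        abs_stripTorusRe_sub_le (hG k) (hG (k + 1)) (hsub k) hκ N x
    _ = A * periodConst κ d * (L ^ k)⁻¹ * Real.exp (-(κ / ((d : ℝ) + 1) * torusSupNorm N x)) := by
        rw [div_eq_mul_inv]; ring

/-- **STRIP RATES, UNIFORM IN THE SCALE, GIVE `NE2ZeroSite`** (general exponent `γ > 0`) — hypothesis-free in the background.
[cite: King1986, Lemma 4.5 (4.38) p.674 (A = 0 sibling, shape)] [folklore] -/
theorem ne2ZeroSite_torus_of_stripRegular_rpow {L : ℝ} (hL : 0 < L) {G : ℕ → (Fin (d + 1) → ℂ) → ℂ} {κ : ℝ}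
    {B : ℕ → ℝ} (hG : ∀ k, StripRegular (G k) κ (B k)) (hκ : 0 < κ) {A γ : ℝ} (hγ : 0 < γ)
    (hsub : ∀ k, StripRegular (fun p => G (k + 1) p - G k p) κ (A * (L ^ k) ^ (-γ))) (d' : ℕ) (p : ℝ) :
    NE2ZeroSite d' p (torusInstance d hL.ne') (torusStepKernels (stripTorusFamily G hG hκ) hL.ne') := by
  refine ne2ZeroSite_torus_of_bound_rpow hL (A := A * periodConst κ d) (δ := κ / ((d : ℝ) + 1)) (by positivity) hγ
    (fun N _ k x => ?_) d' p
  calc |stripTorusFamily G hG hκ N (k + 1) (toT N x) - stripTorusFamily G hG hκ N k (toT N x)|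
      ≤ A * (L ^ k) ^ (-γ) * periodConst κ d * Real.exp (-(κ / (d + 1) * torusSupNorm N x)) :=
        abs_stripTorusRe_sub_le (hG k) (hG (k + 1)) (hsub k) hκ N x
    _ = A * periodConst κ d * (L ^ k) ^ (-γ) * Real.exp (-(κ / ((d : ℝ) + 1) * torusSupNorm N x)) := by ring

/-- The same, first order in `η` (`γ = 1`). [folklore] -/
theorem ne2ZeroSite_torus_of_stripRegular {L : ℝ} (hL : 0 < L) {G : ℕ → (Fin (d + 1) → ℂ) → ℂ} {κ : ℝ}
    {B : ℕ → ℝ} (hG : ∀ k, StripRegular (G k) κ (B k)) (hκ : 0 < κ) {A : ℝ}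
    (hsub : ∀ k, StripRegular (fun p => G (k + 1) p - G k p) κ (A / L ^ k)) (d' : ℕ) (p : ℝ) :
    NE2ZeroSite d' p (torusInstance d hL.ne') (torusStepKernels (stripTorusFamily G hG hκ) hL.ne') := by
  refine ne2ZeroSite_torus_of_bound hL (A := A * periodConst κ d) (δ := κ / ((d : ℝ) + 1)) (by positivity)
    (fun N _ k x => ?_) d' p
  calc |stripTorusFamily G hG hκ N (k + 1) (toT N x) - stripTorusFamily G hG hκ N k (toT N x)|
      ≤ A / L ^ k * periodConst κ d * Real.exp (-(κ / (d + 1) * torusSupNorm N x)) :=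
        abs_stripTorusRe_sub_le (hG k) (hG (k + 1)) (hsub k) hκ N x
    _ = A * periodConst κ d * (L ^ k)⁻¹ * Real.exp (-(κ / ((d : ℝ) + 1) * torusSupNorm N x)) := by
        rw [div_eq_mul_inv]; ring

end StripToSite

/-! ## §2 The (1.63) objects BY NAME -/

section Layer163Objects

/-- THE (1.63) TORUS KERNEL of the coarse multiplier `G_a^{(n)}` of fine offset `a` (direction pair `μ, λ`) on the unit torus of
period vector `N`, at a lattice point `x`: `MultiPeriod.torusKernel (descendC (G163 n μ λ a) …) N x` — literally the object of
`B5Hk163Decay.torusKernel_G163_decay`. [cite: Balaban1984PropagatorsI, (1.63) p.28 (object; packaging `B5Hk163Decay.G163`)] [folklore] -/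
def hk163TorusKernel (n : ℕ) [NeZero n] (μ lam : Fin (d + 1)) (a : Fin (d + 1) → Fin n) (N : Fin (d + 1) → ℕ)
    (x : Fin (d + 1) → ℤ) : ℂ :=
  torusKernel (descendC (fun p : Fin (d + 1) → ℂ => G163 n μ lam a p)
    (stripRegular_G163 n (kappa163_pos _).le le_rfl μ lam a) (kappa163_pos _).le) N x

/-- The (1.63) torus kernel does not depend on the representative: `K(rep(x̄)) = K(x)`. [folklore] -/
theorem hk163TorusKernel_rep_toT (n : ℕ) [NeZero n] (μ lam : Fin (d + 1)) (a : Fin (d + 1) → Fin n)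
    (N : Fin (d + 1) → ℕ) [∀ μ, NeZero (N μ)] (x : Fin (d + 1) → ℤ) :
    hk163TorusKernel n μ lam a N (rep N (toT N x)) = hk163TorusKernel n μ lam a N x :=
  torusKernel_rep_toT _ x

/-- THE (1.63) TORUS KERNEL AS A REAL TORUS FUNCTION (real part, read at the box representative). [folklore] -/
def hk163Re (n : ℕ) [NeZero n] (μ lam : Fin (d + 1)) (a : Fin (d + 1) → Fin n) (N : Fin (d + 1) → ℕ)
    [∀ μ, NeZero (N μ)] (t : Tor N) : ℝ :=
  (hk163TorusKernel n μ lam a N (rep N t)).re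

/-- `hk163Re` IS §1's `stripTorusRe` of b05's strip-regular multiplier `G163 n μ λ a` (definitionally). [folklore] -/
theorem hk163Re_eq_stripTorusRe (n : ℕ) [NeZero n] (μ lam : Fin (d + 1)) (a : Fin (d + 1) → Fin n)
    (N : Fin (d + 1) → ℕ) [∀ μ, NeZero (N μ)] :
    hk163Re n μ lam a N = stripTorusRe (stripRegular_G163 n (kappa163_pos _).le le_rfl μ lam a) (kappa163_pos (d + 1)) N :=
  rfl

/-- the decay rate of the (1.63) torus theorems: `κ₁₆₃(d+1)/(d+1)`. [folklore] -/
def delta163T (d : ℕ) : ℝ := kappa163 (d + 1) / ((d : ℝ) + 1)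

/-- `0 < delta163T d`. [folklore] -/
theorem delta163T_pos (d : ℕ) : 0 < delta163T d := by
  unfold delta163T
  have := kappa163_pos (d + 1)
  positivity

/-- the ZERO fine offset (the coarse point itself) at level `n`. [folklore] -/
def zeroOffset (n : ℕ) [NeZero n] : Fin (d + 1) → Fin n := fun _ => ⟨0, Nat.pos_of_ne_zero (NeZero.ne n)⟩

/-- Zero offsets are physically paired across any two levels: `0·L^k = 0·L^{k+j}`. [folklore] -/
theorem zeroOffset_phys (L : ℕ) [NeZero L] (k j : ℕ) :
    ∀ ν, ((zeroOffset (d := d) (L ^ (k + j)) ν : ℕ)) * L ^ k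
      = ((zeroOffset (d := d) (L ^ k) ν : ℕ)) * L ^ (k + j) :=
  fun ν => by simp [zeroOffset]

/-- THE (1.63) TORUS FAMILY AT THE ZERO FINE OFFSET: `X_N k = Re K^{(L^k)}_{0,N}` (the only offset family consistent for all
`k ≥ 0`: `Fin (L^0) = {0}` forces `a_k = a_0·L^k = 0`). [cite: Balaban1984PropagatorsI, (1.63) p.28 (object)] [folklore] -/
def hk163ZeroFamily (L : ℕ) [NeZero L] (μ lam : Fin (d + 1)) : TorusFamily d :=
  fun N _ k t => hk163Re (L ^ k) μ lam (zeroOffset (L ^ k)) N t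

/-- `hk163ZeroFamily` IS §1's `stripTorusFamily` of the multiplier family `k ↦ G163 (L^k) μ λ 0` (definitionally). [folklore] -/
theorem hk163ZeroFamily_eq_stripTorusFamily (L : ℕ) [NeZero L] (μ lam : Fin (d + 1)) :
    hk163ZeroFamily (d := d) L μ lam
      = stripTorusFamily (fun k p => G163 (L ^ k) μ lam (zeroOffset (L ^ k)) p)
          (fun k => stripRegular_G163 (L ^ k) (kappa163_pos _).le le_rfl μ lam (zeroOffset (L ^ k)))
          (kappa163_pos (d + 1)) :=
  rfl

end Layer163Objects

/-! ## §3 The (1.63) inhabitant at ORDER ZERO, UNCONDITIONALLY: decay and volume-uniformity by name, no η-rate (`γ = 0`) -/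

section Layer163Zero

/-- the order-zero amplitude: `2·MG163(d+1)·periodConst(κ₁₆₃(d+1), d)`. [folklore] -/
def C163T0 (d : ℕ) : ℝ := 2 * MG163 (d + 1) * periodConst (kappa163 (d + 1)) d

/-- **DECAY OF THE (1.63) TORUS FUNCTION, BY NAME** (`B5Hk163Decay.torusKernel_G163_decay`): every `n ≥ 1`, `μ`, `λ`, `a`,
`N`, `x`: `|Re K^{(n)}_{a,N}(x̄)| ≤ MG163(d+1)·periodConst(κ₁₆₃(d+1), d)·e^{−delta163T d·|x|_{T,∞}}`. [folklore] -/
theorem abs_hk163Re_le (n : ℕ) [NeZero n] (μ lam : Fin (d + 1)) (a : Fin (d + 1) → Fin n) (N : Fin (d + 1) → ℕ)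
    [∀ μ, NeZero (N μ)] (x : Fin (d + 1) → ℤ) :
    |hk163Re n μ lam a N (toT N x)|
      ≤ MG163 (d + 1) * periodConst (kappa163 (d + 1)) d * Real.exp (-(delta163T d * torusSupNorm N x)) := by
  have h := torusKernel_G163_decay (d := d) n μ lam a (one_le_M N) x
  calc |hk163Re n μ lam a N (toT N x)| = |(hk163TorusKernel n μ lam a N x).re| := by
        simp only [hk163Re, hk163TorusKernel_rep_toT]
    _ ≤ ‖hk163TorusKernel n μ lam a N x‖ := abs_re_le_norm _
    _ ≤ MG163 (d + 1) * periodConst (kappa163 (d + 1)) d *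
          Real.exp (-(kappa163 (d + 1) / (d + 1) * torusSupNorm N x)) := h
    _ = MG163 (d + 1) * periodConst (kappa163 (d + 1)) d * Real.exp (-(delta163T d * torusSupNorm N x)) := by
        simp only [delta163T]

/-- **THE ORDER-ZERO TWO-LEVEL BOUND** (every pair of levels `n, m ≥ 1`, EVERY pair of offsets — no pairing needed at this order):
`|Re K^{(m)}_{a′,N}(x̄) − Re K^{(n)}_{a,N}(x̄)| ≤ C163T0 d·e^{−delta163T d·|x|_{T,∞}}`.  NO η-rate. [folklore] -/
theorem hk163_step_bound_zero (n m : ℕ) [NeZero n] [NeZero m] (μ lam : Fin (d + 1)) (a : Fin (d + 1) → Fin n)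
    (a' : Fin (d + 1) → Fin m) (N : Fin (d + 1) → ℕ) [∀ μ, NeZero (N μ)] (x : Fin (d + 1) → ℤ) :
    |hk163Re m μ lam a' N (toT N x) - hk163Re n μ lam a N (toT N x)|
      ≤ C163T0 d * Real.exp (-(delta163T d * torusSupNorm N x)) := by
  have h₂ := abs_hk163Re_le m μ lam a' N x
  have h₁ := abs_hk163Re_le n μ lam a N x
  calc |hk163Re m μ lam a' N (toT N x) - hk163Re n μ lam a N (toT N x)|
      ≤ |hk163Re m μ lam a' N (toT N x)| + |hk163Re n μ lam a N (toT N x)| := abs_sub _ _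
    _ ≤ MG163 (d + 1) * periodConst (kappa163 (d + 1)) d * Real.exp (-(delta163T d * torusSupNorm N x))
        + MG163 (d + 1) * periodConst (kappa163 (d + 1)) d * Real.exp (-(delta163T d * torusSupNorm N x)) :=
        add_le_add h₂ h₁
    _ = C163T0 d * Real.exp (-(delta163T d * torusSupNorm N x)) := by unfold C163T0; ring

/-- **THE (1.63) KERNELS INHABIT THE TYPED SITE LAYER AT ORDER ZERO ON EVERY UNIT TORUS, UNCONDITIONALLY** (every `L ≥ 1`, `μ`,
`λ`, levels `k`, `k+1` with ANY offsets, `N`, exponent pair, inert cube size, at `U ≡ 1`):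
`EtaRateIneqSite d′ p (torusStepKernel Xf Xc L M k) (C163T0 d) (delta163T d) 0 U` — exponential decay in the torus distance and
uniformity in the volume BY NAME from b05, but rate exponent `γ = 0`: King's factor `(L^{−γ})^k` is `1`, so this is NOT a rate
statement and does NOT reach `NE2PlusSite` / `NE2ZeroSite` (which demand `γ > 0`); §4 isolates what the strip rate adds.
[cite: Balaban1984PropagatorsI, (1.63) p.28 (object); Balaban1985BackgroundPropagators, Thm 3.2 (3.48) p.398 (normalisation, shape)] [folklore] -/
theorem etaRateIneqSite_hk163_zero (L : ℕ) [NeZero L] (μ lam : Fin (d + 1)) (k : ℕ) (a : Fin (d + 1) → Fin (L ^ k))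
    (a' : Fin (d + 1) → Fin (L ^ (k + 1))) (N : Fin (d + 1) → ℕ) [∀ μ, NeZero (N μ)] (M : ℝ) (d' : ℕ) (p : ℝ)
    (U : pt9Bg.Cfg) :
    EtaRateIneqSite d' p
      (torusStepKernel (hk163Re (L ^ (k + 1)) μ lam a' N) (hk163Re (L ^ k) μ lam a N) (L : ℝ) M k)
      (C163T0 d) (delta163T d) 0 U := by
  refine etaRateIneqSite_torus_of_bound_rpow (by exact_mod_cast Nat.pos_of_ne_zero (NeZero.ne L)) (fun x => ?_) d' p U
  rw [neg_zero, Real.rpow_zero, mul_one]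
  exact hk163_step_bound_zero (L ^ k) (L ^ (k + 1)) μ lam a a' N x

end Layer163Zero

/-! ## §4 The (1.63) inhabitant at FIRST ORDER in `η`, CONDITIONALLY on the strip rate of the level difference -/

section Layer163Conditional

/-- **STRIP RATE OF THE LEVEL DIFFERENCE ⇒ THE (1.63) TORUS STEP BOUND** (every `L ≥ 1`, `μ`, `λ`, `k`, offsets `a` at level
`L^k` and `a′` at level `L^{k+1}`, every `N`, `x`): IF `G_{a′}^{(L^{k+1})} − G_a^{(L^k)}` is strip-regular on `Strip (d+1) κ₁₆₃(d+1)`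
with bound `A/L^k`, THEN `|Re K^{(L^{k+1})}_{a′,N}(x̄) − Re K^{(L^k)}_{a,N}(x̄)| ≤ (A·periodConst(κ₁₆₃(d+1),d))·(L^k)⁻¹·e^{−delta163T d·|x|_{T,∞}}`.
The hypothesis is discharged in the tree by `T4Hk163StripRate.stripRegular_G163_sub` (`A = CGe(d+1)`, physically paired offsets
`a′·L^k = a·L^{k+1}`); that discharge is the companion leaf `T4EtaRateSiteTorus163King`, not this file. [folklore] -/
theorem hk163_step_bound_of_stripRate (L : ℕ) [NeZero L] (μ lam : Fin (d + 1)) (k : ℕ)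
    (a : Fin (d + 1) → Fin (L ^ k)) (a' : Fin (d + 1) → Fin (L ^ (k + 1))) {A : ℝ}
    (hsub : StripRegular (d := d)
      (fun p => G163 (L ^ (k + 1)) μ lam a' p - G163 (L ^ k) μ lam a p) (kappa163 (d + 1)) (A / (L : ℝ) ^ k))
    (N : Fin (d + 1) → ℕ) [∀ μ, NeZero (N μ)] (x : Fin (d + 1) → ℤ) :
    |hk163Re (L ^ (k + 1)) μ lam a' N (toT N x) - hk163Re (L ^ k) μ lam a N (toT N x)|
      ≤ A * periodConst (kappa163 (d + 1)) d * ((L : ℝ) ^ k)⁻¹ * Real.exp (-(delta163T d * torusSupNorm N x)) := by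
  have h := abs_stripTorusRe_sub_le (stripRegular_G163 (L ^ k) (kappa163_pos _).le le_rfl μ lam a)
    (stripRegular_G163 (L ^ (k + 1)) (kappa163_pos _).le le_rfl μ lam a') hsub (kappa163_pos (d + 1)) N x
  calc |hk163Re (L ^ (k + 1)) μ lam a' N (toT N x) - hk163Re (L ^ k) μ lam a N (toT N x)|
      ≤ A / (L : ℝ) ^ k * periodConst (kappa163 (d + 1)) d *
          Real.exp (-(kappa163 (d + 1) / (d + 1) * torusSupNorm N x)) := h
    _ = A * periodConst (kappa163 (d + 1)) d * ((L : ℝ) ^ k)⁻¹ * Real.exp (-(delta163T d * torusSupNorm N x)) := by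
        simp only [delta163T, div_eq_mul_inv]
        ring

/-- **STRIP RATE ⇒ THE (1.63) KERNELS INHABIT THE TYPED SITE LAYER AT FIRST ORDER** (every `L ≥ 1`, `μ`, `λ`, `k`, offsets, `N`,
exponent pair, inert cube size, at `U ≡ 1`): under the strip-rate hypothesis of `hk163_step_bound_of_stripRate`,
`EtaRateIneqSite d′ p (torusStepKernel (Re K^{(L^{k+1})}_{a′,N}) (Re K^{(L^k)}_{a,N}) L M k) (A·periodConst(κ₁₆₃(d+1),d)) (delta163T d) 1 U`.
CONDITIONAL as typed. [cite: Balaban1984PropagatorsI, (1.63) p.28 (object); Balaban1985BackgroundPropagators, Thm 3.2 (3.48) p.398 (normalisation, shape)] [folklore] -/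
theorem etaRateIneqSite_hk163_of_stripRate (L : ℕ) [NeZero L] (μ lam : Fin (d + 1)) (k : ℕ)
    (a : Fin (d + 1) → Fin (L ^ k)) (a' : Fin (d + 1) → Fin (L ^ (k + 1))) {A : ℝ}
    (hsub : StripRegular (d := d)
      (fun p => G163 (L ^ (k + 1)) μ lam a' p - G163 (L ^ k) μ lam a p) (kappa163 (d + 1)) (A / (L : ℝ) ^ k))
    (N : Fin (d + 1) → ℕ) [∀ μ, NeZero (N μ)] (M : ℝ) (d' : ℕ) (p : ℝ) (U : pt9Bg.Cfg) :
    EtaRateIneqSite d' p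
      (torusStepKernel (hk163Re (L ^ (k + 1)) μ lam a' N) (hk163Re (L ^ k) μ lam a N) (L : ℝ) M k)
      (A * periodConst (kappa163 (d + 1)) d) (delta163T d) 1 U :=
  etaRateIneqSite_torus_of_bound (by exact_mod_cast Nat.pos_of_ne_zero (NeZero.ne L))
    (hk163_step_bound_of_stripRate L μ lam k a a' hsub N) d' p U

/-- **STRIP RATES AT THE ZERO OFFSET, UNIFORM IN THE SCALE ⇒ `NE2PlusSite` FOR THE (1.63) ZERO-OFFSET TORUS FAMILY, UNIFORMLY IN
THE VOLUME** (every `L ≥ 1`, `μ`, `λ`; constants `(M₅, δ, a₀, C, γ) = (1, delta163T d, 1, max (A·periodConst(κ₁₆₃(d+1),d)) 1, 1)`),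
for every exponent pair and geometric constant — IF `StripRegular (G_0^{(L^{k+1})} − G_0^{(L^k)}) κ₁₆₃(d+1) (A/L^k)` for every `k`.
CONDITIONAL as typed (discharge: `T4Hk163StripRate.stripRegular_G163_sub` with `zeroOffset_phys`, in the companion leaf).  HONEST
SCOPE (i): NE2⁰ content inside NE2⁺'s type; NOT NE2⁺.
[cite: Balaban1984PropagatorsI, (1.63) p.28 (object); Balaban1985BackgroundPropagators, Thm 3.14 pp.426–427 (quantifier template, as typed by `T4EtaRate.NE2PlusSite`)] [folklore] -/
theorem ne2PlusSite_hk163Zero_of_stripRate (L : ℕ) [NeZero L] (μ lam : Fin (d + 1)) {A : ℝ}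
    (hsub : ∀ k : ℕ, StripRegular (d := d)
      (fun p => G163 (L ^ (k + 1)) μ lam (zeroOffset (L ^ (k + 1))) p - G163 (L ^ k) μ lam (zeroOffset (L ^ k)) p)
      (kappa163 (d + 1)) (A / (L : ℝ) ^ k))
    (d' : ℕ) (p c35 : ℝ) :
    NE2PlusSite d' p c35
      (torusInstance d (L := (L : ℝ)) (by exact_mod_cast NeZero.ne L))
      (torusStepKernels (hk163ZeroFamily (d := d) L μ lam) (by exact_mod_cast NeZero.ne L)) := by
  have hL : (0 : ℝ) < L := by exact_mod_cast Nat.pos_of_ne_zero (NeZero.ne L)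
  refine ne2PlusSite_torus_of_bound hL (A := A * periodConst (kappa163 (d + 1)) d) (delta163T_pos d)
    (fun N _ k x => ?_) d' p c35
  exact hk163_step_bound_of_stripRate L μ lam k (zeroOffset (L ^ k)) (zeroOffset (L ^ (k + 1))) (hsub k) N x

/-- **… AND `NE2ZeroSite`** for the (1.63) zero-offset torus family (every `L ≥ 1`; `γ = 1`, `δ = delta163T d`), hypothesis-free
in the background, CONDITIONAL on the same scale-uniform strip rates.
[cite: Balaban1984PropagatorsI, (1.63) p.28 (object); King1986, Lemma 4.5 (4.38) p.674 (A = 0 sibling, shape)] [folklore] -/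
theorem ne2ZeroSite_hk163Zero_of_stripRate (L : ℕ) [NeZero L] (μ lam : Fin (d + 1)) {A : ℝ}
    (hsub : ∀ k : ℕ, StripRegular (d := d)
      (fun p => G163 (L ^ (k + 1)) μ lam (zeroOffset (L ^ (k + 1))) p - G163 (L ^ k) μ lam (zeroOffset (L ^ k)) p)
      (kappa163 (d + 1)) (A / (L : ℝ) ^ k))
    (d' : ℕ) (p : ℝ) :
    NE2ZeroSite d' p
      (torusInstance d (L := (L : ℝ)) (by exact_mod_cast NeZero.ne L))
      (torusStepKernels (hk163ZeroFamily (d := d) L μ lam) (by exact_mod_cast NeZero.ne L)) := by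
  have hL : (0 : ℝ) < L := by exact_mod_cast Nat.pos_of_ne_zero (NeZero.ne L)
  refine ne2ZeroSite_torus_of_bound hL (A := A * periodConst (kappa163 (d + 1)) d) (delta163T_pos d)
    (fun N _ k x => ?_) d' p
  exact hk163_step_bound_of_stripRate L μ lam k (zeroOffset (L ^ k)) (zeroOffset (L ^ (k + 1))) (hsub k) N x

end Layer163Conditional

end

end Literature.MathematicalPhysics.QuantumFieldTheory.Balaban1983to89.T4EtaRateSiteTorus163
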